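import Mathlib.Analysis.PSeries
import Literature.Barriers.CriticalPhenomena.LaceExpansionHighDimensionProofs
import Literature.Barriers.CriticalPhenomena.SpanningClustersAboveSix
import HarnessLib

/-!
# Lattice sums for the spanning-cluster barrier: Riesz weights, their convolutions, and plate sums

Barrier catalogue `Literature/Barriers/CriticalPhenomena/` (D-0021), companion of
`SpanningClustersAboveSix.lean` (Aizenman 1997, Thm. 4). The diagrammatic estimates of
Aizenman 1997, §4 ("each diagram has `(2k-2)` vertices and `(2k-3)` lines … the sum yields
`k! C_d^k L^{d(2k-2)}/L^{(4-2η)k}`", proof of Lemma 2; "the 'truncation' results diagrammatically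
in the addition of two sites and three lines, which translates to the multiplicative factor of
order `L^{2d}/L^{3(d-2+η)} = L^{d-6+3η}`", proof of Lemma 3) rest on elementary lattice sums of
the weight `|x|^{2-d}` of condition (t-c). (Section numbers follow the arXiv version, whose §4 is
"Above the upper critical dimension"; the catalogue file `SpanningClustersAboveSix.lean` refers
to the same section as §5.) This file proves the ones needed for `k = 2` (all PROVED, sup norm
`‖·‖_∞` on `ℤ^d`, natural-number exponents):

* `rieszRadius z = max(1, ‖z‖_∞)` and the **Riesz weight** `rieszWt a z = rieszRadius(z)^{-a}`;
* `sum_box_rieszWt_le` — ball sums `Σ_{‖z‖ ≤ R} rieszRadius(z)^{-a} ≤ K₁ (R+1)^{d-a}` (`a ≤ d-1`);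
* `sum_sdiff_rieszWt_le` — tail sums `Σ_{‖z‖ > M} rieszRadius(z)^{-b} ≤ K₂ (M+1)^{d-b}` (`b ≥ d+1`);
* `sum_rieszWt_mul_rieszWt_le` — the **discrete convolution of two Riesz weights**:
  `Σ_u rieszRadius(x-u)^{-α} rieszRadius(u-y)^{-β} ≤ K rieszRadius(x-y)^{d-α-β}` for `α, β ≤ d-1`,
  `α + β ≥ d+1` (uniformly over finite summation ranges) — the case `a < d`, `a + b > d` of the
  convolution bound of Hara–van der Hofstad–Slade 2003, Prop. 1.7 (i), here for the regularised
  sup-norm weight `max(1,‖x‖_∞)^{-a}` in place of `(|x|+1)^{-a}` and with the crude explicit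
  constant `rieszConvConst d`;
* `plate n L c` — the section `{x₀ = c}` of the cylinder over `Λ_L^{(n)}` in `ℤ^{n+1}`, equal to
  `{x ∈ Λ_L | x₀ = c}` for `|c| ≤ L` (`plate_subset_box`); the faces `∂Λ_∓` of Aizenman 1997, §4
  are `c = ∓L` and coincide with `leftFace`/`rightFace` of `SpanningClustersAboveSix.lean`
  (`coe_plate_neg_eq_leftFace`, `coe_plate_eq_rightFace`); `card_plate`, and the **plate sum**
  `Σ_{x ∈ plate} rieszRadius(x-u)^{-a} ≤ rieszPlateConst n · (2L+1)` for `n = a + 1` uniformly in `u`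
  (`sum_plate_rieszWt_sub_le`, `rieszPlateConst n = rieszBallConst n + 1`), the estimate behind
  `E(Σ_{x ∈ ∂Λ_-} 1[x ↔ u]) ≲ L`.

## References

* M. Aizenman, *On the number of incipient spanning clusters*, Nuclear Phys. B 485 (1997)
  551–582, arXiv:cond-mat/9609240, §4 of the arXiv version: condition (t-c), `Λ_L`, `∂Λ_∓`,
  Lemmas 2–3 and their proofs.
* T. Hara, R. van der Hofstad, G. Slade, *Critical two-point functions and the lace expansion for
  spread-out high-dimensional percolation and related models*, Ann. Probab. 31 (2003) 349–408,
  Prop. 1.7 (i) (= Prop. 1.3.2 (i) of arXiv:math-ph/0011046): "If `|f(x)| ≤ (|x|+1)^{-a}` and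
  `|g(x)| ≤ (|x|+1)^{-b}` with `a ≥ b > 0`, then … `|(f*g)(x)| ≤ C(|x|+1)^{d-(a+b)}`
  (`a < d` and `a + b > d`)".
-/

noncomputable section

namespace Literature.Barriers.CriticalPhenomena

open Finset Literature.Probability.LatticeModels

variable {d : ℕ}

/-! ### The rieszRadius `max(1, ‖z‖_∞)` and the Riesz weight -/

section Riesz

/-- `rieszRadius z = max(1, ‖z‖_∞)`, the regularised sup norm of a lattice point. [folklore] -/
def rieszRadius (z : Site d) : ℕ := max 1 (Site.supNorm z)

/-- `rieszRadius z ≥ 1`. [folklore] -/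
theorem one_le_rieszRadius (z : Site d) : 1 ≤ rieszRadius z := le_max_left _ _

/-- `‖z‖_∞ ≤ rieszRadius z`. [folklore] -/
theorem supNorm_le_rieszRadius (z : Site d) : Site.supNorm z ≤ rieszRadius z := le_max_right _ _

/-- `rieszRadius z = ‖z‖_∞` when `‖z‖_∞ ≥ 1`. [folklore] -/
theorem rieszRadius_eq_supNorm {z : Site d} (h : 1 ≤ Site.supNorm z) : rieszRadius z = Site.supNorm z :=
  max_eq_right h

/-- `rieszRadius 0 = 1`. [folklore] -/
@[simp] theorem rieszRadius_zero : rieszRadius (0 : Site d) = 1 := by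
  rw [rieszRadius, Site.supNorm_eq_zero_iff.2 rfl]; rfl

/-- `rieszRadius z > 0` as a real number. [folklore] -/
theorem rieszRadius_pos (z : Site d) : (0 : ℝ) < rieszRadius z := by exact_mod_cast one_le_rieszRadius z

/-- `‖-z‖_∞ = ‖z‖_∞`. This is `Site.supNorm_neg` of `LatticeModels/SharpnessSubcritical.lean`,
which lives outside this file's import closure; restated rather than importing that file.
(librarian: relocate `Site.supNorm_neg` to `SharpnessProofs.lean` next to `Site.supNorm_add_le`,
then delete this restatement.) [folklore] -/
private theorem supNorm_neg' (z : Site d) : Site.supNorm (-z) = Site.supNorm z := by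
  simp [Site.supNorm]

/-- `rieszRadius (-z) = rieszRadius z`. [folklore] -/
theorem rieszRadius_neg (z : Site d) : rieszRadius (-z) = rieszRadius z := by rw [rieszRadius, rieszRadius, supNorm_neg']

/-- `rieszRadius (x - y) = rieszRadius (y - x)`. [folklore] -/
theorem rieszRadius_sub_comm (x y : Site d) : rieszRadius (x - y) = rieszRadius (y - x) := by
  rw [← rieszRadius_neg, neg_sub]

/-- Triangle inequality for the integer sup norm, difference form. [folklore] -/
theorem supNorm_sub_le (x u y : Site d) :
    Site.supNorm (x - y) ≤ Site.supNorm (x - u) + Site.supNorm (u - y) := by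
  have h := Site.supNorm_add_le (x - u) (u - y)
  rwa [sub_add_sub_cancel] at h

/-- The **Riesz weight** `rieszRadius(z)^{-a} = max(1, ‖z‖_∞)^{-a}` (the weight `|x|^{2-d}` of
Aizenman's condition (t-c) is `rieszWt (d-2)`, regularised at the origin).
[cite: Aizenman1997, §4 (condition (t-c))] -/
def rieszWt (a : ℕ) (z : Site d) : ℝ := (((rieszRadius z : ℕ) : ℝ) ^ a)⁻¹

/-- Unfolding lemma. [folklore] -/
theorem rieszWt_def (a : ℕ) (z : Site d) : rieszWt a z = (((rieszRadius z : ℕ) : ℝ) ^ a)⁻¹ := rfl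

/-- `rieszWt a z > 0`. [folklore] -/
theorem rieszWt_pos (a : ℕ) (z : Site d) : 0 < rieszWt a z :=
  inv_pos.2 (pow_pos (rieszRadius_pos z) a)

/-- `rieszWt a z ≥ 0`. [folklore] -/
theorem rieszWt_nonneg (a : ℕ) (z : Site d) : 0 ≤ rieszWt a z := (rieszWt_pos a z).le

/-- `rieszWt a z ≤ 1`. [folklore] -/
theorem rieszWt_le_one (a : ℕ) (z : Site d) : rieszWt a z ≤ 1 :=
  inv_le_one_of_one_le₀ (one_le_pow₀ (by exact_mod_cast one_le_rieszRadius z))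

/-- `rieszWt a 0 = 1`. [folklore] -/
@[simp] theorem rieszWt_zero (a : ℕ) : rieszWt a (0 : Site d) = 1 := by simp [rieszWt]

/-- `rieszWt a (-z) = rieszWt a z`. [folklore] -/
theorem rieszWt_neg (a : ℕ) (z : Site d) : rieszWt a (-z) = rieszWt a z := by
  rw [rieszWt, rieszWt, rieszRadius_neg]

/-- `rieszWt a (x - y) = rieszWt a (y - x)`. [folklore] -/
theorem rieszWt_sub_comm (a : ℕ) (x y : Site d) : rieszWt a (x - y) = rieszWt a (y - x) := by
  rw [rieszWt, rieszWt, rieszRadius_sub_comm]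

/-- `rieszWt (a + b) z = rieszWt a z * rieszWt b z`. [folklore] -/
theorem rieszWt_add (a b : ℕ) (z : Site d) : rieszWt (a + b) z = rieszWt a z * rieszWt b z := by
  rw [rieszWt, rieszWt, rieszWt, pow_add, mul_inv]

/-- The Riesz weight is antitone in the rieszRadius (points of possibly different dimensions).
[folklore] -/
theorem rieszWt_le_rieszWt_of_rieszRadius_le (a : ℕ) {d' : ℕ} {z : Site d} {z' : Site d'}
    (h : rieszRadius z ≤ rieszRadius z') : rieszWt a z' ≤ rieszWt a z := by
  rw [rieszWt, rieszWt]
  exact inv_anti₀ (pow_pos (rieszRadius_pos z) a) (pow_le_pow_left₀ (rieszRadius_pos z).le (by exact_mod_cast h) a)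

/-- If `‖z‖_∞ ≥ R ≥ 1` then `rieszWt a z ≤ R^{-a}`. [folklore] -/
theorem rieszWt_le_inv_pow (a : ℕ) {z : Site d} {R : ℕ} (hR : 1 ≤ R) (h : R ≤ Site.supNorm z) :
    rieszWt a z ≤ (((R : ℕ) : ℝ) ^ a)⁻¹ := by
  rw [rieszWt]
  have hR0 : (0 : ℝ) < R := by exact_mod_cast hR
  exact inv_anti₀ (pow_pos hR0 a)
    (pow_le_pow_left₀ hR0.le (by exact_mod_cast h.trans (supNorm_le_rieszRadius z)) a)

/-- For `z ≠ 0`, `rieszWt a z = 1/‖z‖_∞^a` (the form of `TwoPointBoundedRatio.natPow`). [folklore] -/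
theorem rieszWt_eq_inv_norm_pow (a : ℕ) {z : Site d} (hz : z ≠ 0) : rieszWt a z = (‖z‖ ^ a)⁻¹ := by
  have h1 : 1 ≤ Site.supNorm z := by
    rw [Nat.one_le_iff_ne_zero]; exact fun h => hz (Site.supNorm_eq_zero_iff.1 h)
  rw [rieszWt, rieszRadius_eq_supNorm h1, Site.norm_eq_supNorm]

/-- `rieszWt a z` as a function of the sup norm (for the shell decompositions). [folklore] -/
theorem rieszWt_eq_fun_supNorm (a : ℕ) (z : Site d) :
    rieszWt a z = (fun k : ℕ => ((((max 1 k : ℕ) : ℝ)) ^ a)⁻¹) (Site.supNorm z) := rfl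

end Riesz

/-! ### Ball sums and tail sums of the Riesz weight -/

section Shells

/-- The constant `K₁ = 1 + 2d·3^{d-1}` of the ball sums. [folklore] -/
def rieszBallConst (d : ℕ) : ℝ := 1 + 2 * d * 3 ^ (d - 1)

/-- The constant `K₂ = 4d·3^{d-1}` of the tail sums. [folklore] -/
def rieszTailConst (d : ℕ) : ℝ := 4 * d * 3 ^ (d - 1)

/-- `K₁ ≥ 1`. [folklore] -/
theorem one_le_rieszBallConst (d : ℕ) : 1 ≤ rieszBallConst d := by
  unfold rieszBallConst; have : (0 : ℝ) ≤ 2 * d * 3 ^ (d - 1) := by positivity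
  linarith

/-- `K₂ ≥ 0`. [folklore] -/
theorem rieszTailConst_nonneg (d : ℕ) : 0 ≤ rieszTailConst d := by unfold rieszTailConst; positivity

/-- **Ball sum of the Riesz weight** (crude shell bound): for `d = a + e + 1` (i.e. `a ≤ d - 1`),
`Σ_{z ∈ Λ_R} rieszRadius(z)^{-a} ≤ K₁ (R+1)^{e+1} = K₁ (R+1)^{d-a}`. [folklore] -/
theorem sum_box_rieszWt_le {a e : ℕ} (hd : d = a + e + 1) (R : ℕ) :
    ∑ z ∈ box d R, rieszWt a z ≤ rieszBallConst d * ((R : ℝ) + 1) ^ (e + 1) := by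
  classical
  have hd1 : 1 ≤ d := by omega
  have hsplit : ∑ z ∈ box d R, rieszWt a z = rieszWt a (0 : Site d) + ∑ z ∈ (box d R).erase 0, rieszWt a z :=
    (Finset.add_sum_erase _ _ (zero_mem_box d R)).symm
  rw [hsplit, rieszWt_zero]
  have hshell : ∑ z ∈ (box d R).erase 0, rieszWt a z =
      ∑ k ∈ Finset.range R, (#(sphere d (k + 1)) : ℝ) * ((((k + 1 : ℕ) : ℝ)) ^ a)⁻¹ := by
    have h := sum_box_erase_zero_eq_sum_range (d := d) (fun k : ℕ => ((((max 1 k : ℕ) : ℝ)) ^ a)⁻¹) R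
    simp only [← rieszWt_eq_fun_supNorm] at h
    rw [h]
    refine Finset.sum_congr rfl fun k _ => ?_
    rw [show max 1 (k + 1) = k + 1 from max_eq_right (by omega)]
  rw [hshell]
  have hterm : ∀ k ∈ Finset.range R,
      (#(sphere d (k + 1)) : ℝ) * ((((k + 1 : ℕ) : ℝ)) ^ a)⁻¹ ≤ 2 * d * 3 ^ (d - 1) * ((R : ℝ) + 1) ^ e := by
    intro k hk
    have hk1 : (0 : ℝ) < (k : ℝ) + 1 := by positivity
    have hkR : (k : ℝ) + 1 ≤ (R : ℝ) + 1 := by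
      have := Finset.mem_range.1 hk
      exact_mod_cast (by omega : k + 1 ≤ R + 1)
    have hcard := card_sphere_succ_le' (d := d) hd1 k
    rw [show d - 1 = a + e by omega] at hcard ⊢
    push_cast
    calc (#(sphere d (k + 1)) : ℝ) * (((k : ℝ) + 1) ^ a)⁻¹
        ≤ 2 * d * 3 ^ (a + e) * ((k : ℝ) + 1) ^ (a + e) * (((k : ℝ) + 1) ^ a)⁻¹ := by gcongr
      _ = 2 * d * 3 ^ (a + e) * ((k : ℝ) + 1) ^ e := by
          rw [pow_add ((k : ℝ) + 1) a e]; field_simp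
      _ ≤ 2 * d * 3 ^ (a + e) * ((R : ℝ) + 1) ^ e := by gcongr
  calc 1 + ∑ k ∈ Finset.range R, (#(sphere d (k + 1)) : ℝ) * ((((k + 1 : ℕ) : ℝ)) ^ a)⁻¹
      ≤ 1 + ∑ k ∈ Finset.range R, (2 * d * 3 ^ (d - 1) * ((R : ℝ) + 1) ^ e : ℝ) :=
        add_le_add le_rfl (Finset.sum_le_sum hterm)
    _ = 1 + R * (2 * d * 3 ^ (d - 1) * ((R : ℝ) + 1) ^ e) := by
        rw [Finset.sum_const, Finset.card_range, nsmul_eq_mul]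
    _ ≤ ((R : ℝ) + 1) ^ (e + 1) + ((R : ℝ) + 1) * (2 * d * 3 ^ (d - 1) * ((R : ℝ) + 1) ^ e) := by
        gcongr
        · exact one_le_pow₀ (by linarith [(Nat.cast_nonneg R : (0 : ℝ) ≤ R)])
        · linarith
    _ = rieszBallConst d * ((R : ℝ) + 1) ^ (e + 1) := by rw [rieszBallConst]; ring

/-- **Tail sum of the Riesz weight**: for `b = d + 1 + t` (i.e. `b ≥ d + 1`), `d ≥ 1`,
`Σ_{z ∈ Λ_N ∖ Λ_M} rieszRadius(z)^{-b} ≤ K₂ (M+1)^{-(t+1)} = K₂ (M+1)^{d-b}`, uniformly in `N`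
(shells, `|∂Λ_k| ≤ 2d3^{d-1}k^{d-1}`, and `Σ_{k > M} k^{-2} ≤ 2/(M+1)`). [folklore] -/
theorem sum_sdiff_rieszWt_le (hd1 : 1 ≤ d) (t M N : ℕ) :
    ∑ z ∈ box d N \ box d M, rieszWt (d + 1 + t) z ≤ rieszTailConst d * ((((M : ℝ) + 1)) ^ (t + 1))⁻¹ := by
  classical
  rcases le_or_gt N M with hNM | hMN
  · rw [Finset.sdiff_eq_empty_iff_subset.2 (box_mono d hNM), Finset.sum_empty]
    exact mul_nonneg (rieszTailConst_nonneg d) (inv_nonneg.2 (by positivity))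
  have h := sum_box_sdiff_box_eq_sum_Ico (d := d) (fun k : ℕ => ((((max 1 k : ℕ) : ℝ)) ^ (d + 1 + t))⁻¹) hMN.le
  simp only [← rieszWt_eq_fun_supNorm] at h
  rw [h]
  have hM1 : (0 : ℝ) < (M : ℝ) + 1 := by positivity
  -- one shell
  have hterm : ∀ k ∈ Finset.Ico M N,
      (#(sphere d (k + 1)) : ℝ) * ((((max 1 (k + 1) : ℕ) : ℝ)) ^ (d + 1 + t))⁻¹ ≤
        2 * d * 3 ^ (d - 1) * ((((M : ℝ) + 1) ^ t)⁻¹ * ((((k + 1 : ℕ) : ℝ)) ^ 2)⁻¹) := by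
    intro k hk
    have hMk : M ≤ k := (Finset.mem_Ico.1 hk).1
    have hk1 : (0 : ℝ) < (k : ℝ) + 1 := by positivity
    have hMk' : (M : ℝ) + 1 ≤ (k : ℝ) + 1 := by exact_mod_cast Nat.succ_le_succ hMk
    rw [show max 1 (k + 1) = k + 1 from max_eq_right (by omega)]
    have hcard := card_sphere_succ_le' (d := d) hd1 k
    push_cast
    have hsplit : ((k : ℝ) + 1) ^ (d + 1 + t) = ((k : ℝ) + 1) ^ (d - 1) * (((k : ℝ) + 1) ^ t * ((k : ℝ) + 1) ^ 2) := by
      rw [← pow_add, ← pow_add]; congr 1; omega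
    calc (#(sphere d (k + 1)) : ℝ) * (((k : ℝ) + 1) ^ (d + 1 + t))⁻¹
        ≤ 2 * d * 3 ^ (d - 1) * ((k : ℝ) + 1) ^ (d - 1) * (((k : ℝ) + 1) ^ (d + 1 + t))⁻¹ := by gcongr
      _ = 2 * d * 3 ^ (d - 1) * ((((k : ℝ) + 1) ^ t)⁻¹ * (((k : ℝ) + 1) ^ 2)⁻¹) := by
          rw [hsplit, mul_inv, mul_inv, mul_assoc (2 * d * 3 ^ (d - 1) : ℝ), ← mul_assoc (((k : ℝ) + 1) ^ (d - 1)),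
            mul_inv_cancel₀ (pow_ne_zero _ hk1.ne'), one_mul]
      _ ≤ 2 * d * 3 ^ (d - 1) * ((((M : ℝ) + 1) ^ t)⁻¹ * (((k : ℝ) + 1) ^ 2)⁻¹) := by
          gcongr
  -- the tail `Σ_{M ≤ k < N} (k+1)^{-2} ≤ 2/(M+1)`
  have htail : ∑ k ∈ Finset.Ico M N, ((((k + 1 : ℕ) : ℝ)) ^ 2)⁻¹ ≤ 2 / ((M : ℝ) + 1) := by
    have h1 : ∑ k ∈ Finset.Ico M N, ((((k + 1 : ℕ) : ℝ)) ^ 2)⁻¹ = ∑ i ∈ Finset.Ioo M (N + 1), (((i : ℕ) : ℝ) ^ 2)⁻¹ := by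
      rw [Finset.sum_Ico_add' (fun i : ℕ => (((i : ℕ) : ℝ) ^ 2)⁻¹) M N 1, Finset.Ico_add_one_left_eq_Ioo]
    rw [h1]
    exact sum_Ioo_inv_sq_le M (N + 1)
  calc ∑ k ∈ Finset.Ico M N, (#(sphere d (k + 1)) : ℝ) * ((((max 1 (k + 1) : ℕ) : ℝ)) ^ (d + 1 + t))⁻¹
      ≤ ∑ k ∈ Finset.Ico M N, 2 * d * 3 ^ (d - 1) * ((((M : ℝ) + 1) ^ t)⁻¹ * ((((k + 1 : ℕ) : ℝ)) ^ 2)⁻¹) :=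
        Finset.sum_le_sum hterm
    _ = 2 * d * 3 ^ (d - 1) * (((M : ℝ) + 1) ^ t)⁻¹ * ∑ k ∈ Finset.Ico M N, ((((k + 1 : ℕ) : ℝ)) ^ 2)⁻¹ := by
        rw [Finset.mul_sum]; refine Finset.sum_congr rfl fun k _ => ?_; ring
    _ ≤ 2 * d * 3 ^ (d - 1) * (((M : ℝ) + 1) ^ t)⁻¹ * (2 / ((M : ℝ) + 1)) := by gcongr
    _ = rieszTailConst d * ((((M : ℝ) + 1)) ^ (t + 1))⁻¹ := by
        rw [rieszTailConst, pow_succ]; field_simp; ring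

/-- Tail sum over an arbitrary finite set: `Σ_{z ∈ S, z ∉ Λ_M} rieszRadius(z)^{-b} ≤ K₂ (M+1)^{d-b}`.
[folklore] -/
theorem sum_filter_not_mem_box_rieszWt_le (hd1 : 1 ≤ d) (t M : ℕ) (S : Finset (Site d)) :
    ∑ z ∈ S with z ∉ box d M, rieszWt (d + 1 + t) z ≤ rieszTailConst d * ((((M : ℝ) + 1)) ^ (t + 1))⁻¹ := by
  classical
  set N := S.sup Site.supNorm with hN
  have hsub : S.filter (fun z => z ∉ box d M) ⊆ box d N \ box d M := by
    intro z hz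
    rw [Finset.mem_filter] at hz
    refine Finset.mem_sdiff.2 ⟨?_, hz.2⟩
    rw [mem_box_iff_supNorm_le]
    exact Finset.le_sup (f := Site.supNorm) hz.1
  exact (Finset.sum_le_sum_of_subset_of_nonneg hsub fun z _ _ => rieszWt_nonneg _ z).trans
    (sum_sdiff_rieszWt_le hd1 t M N)

/-- Ball sum over an arbitrary finite set: `Σ_{z ∈ S, ‖z‖ ≤ R} rieszRadius(z)^{-a} ≤ K₁ (R+1)^{d-a}`.
[folklore] -/
theorem sum_filter_mem_box_rieszWt_le {a e : ℕ} (hd : d = a + e + 1) (R : ℕ) (S : Finset (Site d)) :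
    ∑ z ∈ S with z ∈ box d R, rieszWt a z ≤ rieszBallConst d * ((R : ℝ) + 1) ^ (e + 1) := by
  classical
  have hsub : S.filter (fun z => z ∈ box d R) ⊆ box d R := fun z hz => (Finset.mem_filter.1 hz).2
  exact (Finset.sum_le_sum_of_subset_of_nonneg hsub fun z _ _ => rieszWt_nonneg _ z).trans
    (sum_box_rieszWt_le hd R)

/-- Re-centring: a sum of `f (x - u)` over `u ∈ S` is the sum of `f` over the image `x - S`.
[folklore] -/
theorem sum_sub_left_eq_sum_image [DecidableEq (Site d)] (f : Site d → ℝ) (x : Site d) (S : Finset (Site d)) :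
    ∑ u ∈ S, f (x - u) = ∑ w ∈ S.image (fun u => x - u), f w := by
  rw [Finset.sum_image fun u _ v _ h => sub_right_injective h]

/-- Re-centring: a sum of `f (u - y)` over `u ∈ S` is the sum of `f` over the image `S - y`.
[folklore] -/
theorem sum_sub_right_eq_sum_image [DecidableEq (Site d)] (f : Site d → ℝ) (y : Site d) (S : Finset (Site d)) :
    ∑ u ∈ S, f (u - y) = ∑ w ∈ S.image (fun u => u - y), f w := by
  rw [Finset.sum_image fun u _ v _ h => sub_left_injective h]

end Shells

/-! ### The discrete convolution of two Riesz weights -/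

section Convolution

/-- The constant of the convolution bound (unoptimised). [folklore] -/
def rieszConvConst (d : ℕ) : ℝ := 2 ^ (d + 1) * rieszBallConst d + 8 ^ d * rieszTailConst d + rieszTailConst d + 1

/-- The convolution constant is positive. [folklore] -/
theorem rieszConvConst_pos (d : ℕ) : 0 < rieszConvConst d := by
  have h1 := one_le_rieszBallConst d
  have h2 := rieszTailConst_nonneg d
  unfold rieszConvConst
  positivity

/-- `Λ_0 = {0}`. This is `box_zero_eq` of `LatticeModels/LatticeGreenRiemannSum.lean`, which lives
outside this file's import closure; restated rather than importing that file. (librarian: relocate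
`box_zero_eq` to `ThermodynamicLimit.lean` next to `box_mono`, then delete this restatement.)
[folklore] -/
private theorem box_zero_eq_singleton : box d 0 = {0} := by
  ext z
  rw [mem_box_iff_supNorm_le, Nat.le_zero, Site.supNorm_eq_zero_iff, Finset.mem_singleton]

/-- Lower bound on the second leg from the triangle inequality: if `‖x - y‖ = R = h + h'` and
`‖x - u‖ ≤ h` then `‖u - y‖ ≥ h'`. [folklore] -/
theorem le_supNorm_sub_of_mem_box {x y u : Site d} {R h h' : ℕ} (hR : Site.supNorm (x - y) = R)
    (hhh' : h + h' = R) (hu : x - u ∈ box d h) : h' ≤ Site.supNorm (u - y) := by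
  have h1 := supNorm_sub_le x u y
  rw [mem_box_iff_supNorm_le] at hu
  omega

/-- The same with the roles of the legs exchanged: if `‖u - y‖ ≤ h` then `‖x - u‖ ≥ h'`. [folklore] -/
theorem le_supNorm_sub_of_mem_box' {x y u : Site d} {R h h' : ℕ} (hR : Site.supNorm (x - y) = R)
    (hhh' : h + h' = R) (hu : u - y ∈ box d h) : h' ≤ Site.supNorm (x - u) := by
  have h1 := supNorm_sub_le x u y
  rw [mem_box_iff_supNorm_le] at hu
  omega

/-- `(h')^{-b} ≤ 2^b R^{-b}` when `1 ≤ R ≤ 2h'`. [folklore] -/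
theorem inv_pow_le_two_pow_mul_inv_pow {R h' : ℕ} (b : ℕ) (hR1 : 1 ≤ R) (h2 : R ≤ 2 * h') :
    ((((h' : ℕ) : ℝ)) ^ b)⁻¹ ≤ 2 ^ b * (((R : ℕ) : ℝ) ^ b)⁻¹ := by
  have hR : (0 : ℝ) < R := by exact_mod_cast hR1
  rw [show (2 : ℝ) ^ b * (((R : ℕ) : ℝ) ^ b)⁻¹ = ((((R : ℕ) : ℝ) / 2) ^ b)⁻¹ by
    rw [div_pow, inv_div, div_eq_mul_inv]]
  refine inv_anti₀ (pow_pos (by positivity) b) (pow_le_pow_left₀ (by positivity) ?_ b)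
  have : ((R : ℕ) : ℝ) ≤ 2 * h' := by exact_mod_cast h2
  linarith

/-- Sums of the Riesz weight re-centred at `x`, over the ball `‖x - u‖ ≤ R`. [folklore] -/
theorem sum_filter_sub_left_mem_box_le {a e : ℕ} (hd : d = a + e + 1) (x : Site d) (R : ℕ)
    (S : Finset (Site d)) :
    ∑ u ∈ S with x - u ∈ box d R, rieszWt a (x - u) ≤ rieszBallConst d * ((R : ℝ) + 1) ^ (e + 1) := by
  classical
  rw [sum_sub_left_eq_sum_image (rieszWt a) x]
  have hsub : (S.filter fun u => x - u ∈ box d R).image (fun u => x - u) ⊆ box d R := by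
    intro w hw
    obtain ⟨u, hu, rfl⟩ := Finset.mem_image.1 hw
    exact (Finset.mem_filter.1 hu).2
  exact (Finset.sum_le_sum_of_subset_of_nonneg hsub fun z _ _ => rieszWt_nonneg _ z).trans
    (sum_box_rieszWt_le hd R)

/-- Sums of the Riesz weight re-centred at `y`, over the ball `‖u - y‖ ≤ R`. [folklore] -/
theorem sum_filter_sub_right_mem_box_le {a e : ℕ} (hd : d = a + e + 1) (y : Site d) (R : ℕ)
    (S : Finset (Site d)) :
    ∑ u ∈ S with u - y ∈ box d R, rieszWt a (u - y) ≤ rieszBallConst d * ((R : ℝ) + 1) ^ (e + 1) := by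
  classical
  rw [sum_sub_right_eq_sum_image (rieszWt a) y]
  have hsub : (S.filter fun u => u - y ∈ box d R).image (fun u => u - y) ⊆ box d R := by
    intro w hw
    obtain ⟨u, hu, rfl⟩ := Finset.mem_image.1 hw
    exact (Finset.mem_filter.1 hu).2
  exact (Finset.sum_le_sum_of_subset_of_nonneg hsub fun z _ _ => rieszWt_nonneg _ z).trans
    (sum_box_rieszWt_le hd R)

/-- Tail sums of the Riesz weight re-centred at `x`, over `‖x - u‖ > M`. [folklore] -/
theorem sum_filter_sub_left_not_mem_box_le (hd1 : 1 ≤ d) (t M : ℕ) (x : Site d)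
    (S : Finset (Site d)) :
    ∑ u ∈ S with x - u ∉ box d M, rieszWt (d + 1 + t) (x - u) ≤
      rieszTailConst d * ((((M : ℝ) + 1)) ^ (t + 1))⁻¹ := by
  classical
  rw [sum_sub_left_eq_sum_image (rieszWt (d + 1 + t)) x]
  set T := (S.filter fun u => x - u ∉ box d M).image (fun u => x - u) with hT
  have hall : ∀ w ∈ T, w ∉ box d M := by
    intro w hw
    obtain ⟨u, hu, rfl⟩ := Finset.mem_image.1 hw
    exact (Finset.mem_filter.1 hu).2
  rw [← Finset.filter_true_of_mem hall]
  exact sum_filter_not_mem_box_rieszWt_le hd1 t M T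

/-- **Region A** of the convolution bound (`‖x - u‖ ≤ h`, where the second leg is long):
`Σ_{‖x-u‖ ≤ h} rieszRadius(x-u)^{-α} rieszRadius(u-y)^{-β} ≤ 2^β K₁ R^{-γ}`. [folklore] -/
theorem convolution_regionA {t i j : ℕ} (hd : d = t + 3 + i + j) {x y : Site d} {R h h' : ℕ}
    (hR : Site.supNorm (x - y) = R) (hR1 : 1 ≤ R) (hhh' : h + h' = R) (h2 : R ≤ 2 * h')
    (hhR : h + 1 ≤ R) (S : Finset (Site d)) :
    ∑ u ∈ S with x - u ∈ box d h, rieszWt (t + 2 + j) (x - u) * rieszWt (t + 2 + i) (u - y) ≤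
      2 ^ (t + 2 + i) * rieszBallConst d * ((((R : ℕ) : ℝ)) ^ (t + 1))⁻¹ := by
  have hR0 : (0 : ℝ) < R := by exact_mod_cast hR1
  have h1' : 1 ≤ h' := by omega
  -- the long leg
  have hB : ∀ u ∈ S.filter (fun u => x - u ∈ box d h),
      rieszWt (t + 2 + i) (u - y) ≤ 2 ^ (t + 2 + i) * ((((R : ℕ) : ℝ)) ^ (t + 2 + i))⁻¹ := by
    intro u hu
    have hu' := (Finset.mem_filter.1 hu).2
    exact (rieszWt_le_inv_pow _ h1' (le_supNorm_sub_of_mem_box hR hhh' hu')).trans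
      (inv_pow_le_two_pow_mul_inv_pow _ hR1 h2)
  -- the short leg
  have hA : ∑ u ∈ S with x - u ∈ box d h, rieszWt (t + 2 + j) (x - u) ≤
      rieszBallConst d * (((R : ℕ) : ℝ)) ^ (i + 1) := by
    refine (sum_filter_sub_left_mem_box_le (a := t + 2 + j) (e := i) (by omega) x h S).trans ?_
    gcongr
    · exact (one_le_rieszBallConst d).trans' zero_le_one |> fun _ => le_trans zero_le_one (one_le_rieszBallConst d)
    · exact_mod_cast hhR
  calc ∑ u ∈ S with x - u ∈ box d h, rieszWt (t + 2 + j) (x - u) * rieszWt (t + 2 + i) (u - y)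
      ≤ ∑ u ∈ S with x - u ∈ box d h,
          rieszWt (t + 2 + j) (x - u) * (2 ^ (t + 2 + i) * ((((R : ℕ) : ℝ)) ^ (t + 2 + i))⁻¹) :=
        Finset.sum_le_sum fun u hu => mul_le_mul_of_nonneg_left (hB u hu) (rieszWt_nonneg _ _)
    _ = (2 ^ (t + 2 + i) * ((((R : ℕ) : ℝ)) ^ (t + 2 + i))⁻¹) *
          ∑ u ∈ S with x - u ∈ box d h, rieszWt (t + 2 + j) (x - u) := by rw [← Finset.sum_mul, mul_comm]
    _ ≤ (2 ^ (t + 2 + i) * ((((R : ℕ) : ℝ)) ^ (t + 2 + i))⁻¹) * (rieszBallConst d * (((R : ℕ) : ℝ)) ^ (i + 1)) :=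
        mul_le_mul_of_nonneg_left hA (by positivity)
    _ = 2 ^ (t + 2 + i) * rieszBallConst d * ((((R : ℕ) : ℝ)) ^ (t + 1))⁻¹ := by
        rw [show t + 2 + i = (t + 1) + (i + 1) by ring, pow_add ((R : ℕ) : ℝ) (t + 1) (i + 1)]
        field_simp

/-- **Region B** of the convolution bound (`‖u - y‖ ≤ h`, where the first leg is long):
`Σ_{‖u-y‖ ≤ h} rieszRadius(x-u)^{-α} rieszRadius(u-y)^{-β} ≤ 2^α K₁ R^{-γ}`. [folklore] -/
theorem convolution_regionB {t i j : ℕ} (hd : d = t + 3 + i + j) {x y : Site d} {R h h' : ℕ}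
    (hR : Site.supNorm (x - y) = R) (hR1 : 1 ≤ R) (hhh' : h + h' = R) (h2 : R ≤ 2 * h')
    (hhR : h + 1 ≤ R) (S : Finset (Site d)) :
    ∑ u ∈ S with u - y ∈ box d h, rieszWt (t + 2 + j) (x - u) * rieszWt (t + 2 + i) (u - y) ≤
      2 ^ (t + 2 + j) * rieszBallConst d * ((((R : ℕ) : ℝ)) ^ (t + 1))⁻¹ := by
  have hR0 : (0 : ℝ) < R := by exact_mod_cast hR1
  have h1' : 1 ≤ h' := by omega
  have hB : ∀ u ∈ S.filter (fun u => u - y ∈ box d h),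
      rieszWt (t + 2 + j) (x - u) ≤ 2 ^ (t + 2 + j) * ((((R : ℕ) : ℝ)) ^ (t + 2 + j))⁻¹ := by
    intro u hu
    have hu' := (Finset.mem_filter.1 hu).2
    exact (rieszWt_le_inv_pow _ h1' (le_supNorm_sub_of_mem_box' hR hhh' hu')).trans
      (inv_pow_le_two_pow_mul_inv_pow _ hR1 h2)
  have hA : ∑ u ∈ S with u - y ∈ box d h, rieszWt (t + 2 + i) (u - y) ≤
      rieszBallConst d * (((R : ℕ) : ℝ)) ^ (j + 1) := by
    refine (sum_filter_sub_right_mem_box_le (a := t + 2 + i) (e := j) (by omega) y h S).trans ?_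
    gcongr
    · exact le_trans zero_le_one (one_le_rieszBallConst d)
    · exact_mod_cast hhR
  calc ∑ u ∈ S with u - y ∈ box d h, rieszWt (t + 2 + j) (x - u) * rieszWt (t + 2 + i) (u - y)
      ≤ ∑ u ∈ S with u - y ∈ box d h,
          (2 ^ (t + 2 + j) * ((((R : ℕ) : ℝ)) ^ (t + 2 + j))⁻¹) * rieszWt (t + 2 + i) (u - y) :=
        Finset.sum_le_sum fun u hu => mul_le_mul_of_nonneg_right (hB u hu) (rieszWt_nonneg _ _)
    _ = (2 ^ (t + 2 + j) * ((((R : ℕ) : ℝ)) ^ (t + 2 + j))⁻¹) *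
          ∑ u ∈ S with u - y ∈ box d h, rieszWt (t + 2 + i) (u - y) := by rw [← Finset.mul_sum]
    _ ≤ (2 ^ (t + 2 + j) * ((((R : ℕ) : ℝ)) ^ (t + 2 + j))⁻¹) * (rieszBallConst d * (((R : ℕ) : ℝ)) ^ (j + 1)) :=
        mul_le_mul_of_nonneg_left hA (by positivity)
    _ = 2 ^ (t + 2 + j) * rieszBallConst d * ((((R : ℕ) : ℝ)) ^ (t + 1))⁻¹ := by
        rw [show t + 2 + j = (t + 1) + (j + 1) by ring, pow_add ((R : ℕ) : ℝ) (t + 1) (j + 1)]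
        field_simp

/-- **Region C** of the convolution bound (both legs long, `‖x - u‖, ‖u - y‖ > h` with
`R ≤ 2(h+1)`): there `rieszRadius(x-u) ≤ 3 rieszRadius(u-y)`, so the summand is at most
`3^β rieszRadius(x-u)^{-(α+β)}`, and the tail sum gives `≤ 3^β 2^γ K₂ R^{-γ}`. [folklore] -/
theorem convolution_regionC {t i j : ℕ} (hd : d = t + 3 + i + j) {x y : Site d} {R h : ℕ}
    (hR : Site.supNorm (x - y) = R) (hR1 : 1 ≤ R) (h2 : R ≤ 2 * (h + 1)) (S : Finset (Site d)) :
    ∑ u ∈ S with (x - u ∉ box d h ∧ u - y ∉ box d h),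
        rieszWt (t + 2 + j) (x - u) * rieszWt (t + 2 + i) (u - y) ≤
      3 ^ (t + 2 + i) * 2 ^ (t + 1) * rieszTailConst d * ((((R : ℕ) : ℝ)) ^ (t + 1))⁻¹ := by
  classical
  have hR0 : (0 : ℝ) < R := by exact_mod_cast hR1
  have hd1 : 1 ≤ d := by omega
  -- pointwise: the second weight is dominated by `3^β` times the weight of the first leg
  have hpt : ∀ u ∈ S.filter (fun u => x - u ∉ box d h ∧ u - y ∉ box d h),
      rieszWt (t + 2 + j) (x - u) * rieszWt (t + 2 + i) (u - y) ≤
        3 ^ (t + 2 + i) * rieszWt (d + 1 + t) (x - u) := by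
    intro u hu
    obtain ⟨hu1, hu2⟩ := (Finset.mem_filter.1 hu).2
    rw [mem_box_iff_supNorm_le, not_le] at hu1 hu2
    have htri : Site.supNorm (x - u) ≤ Site.supNorm (x - y) + Site.supNorm (u - y) := by
      have := supNorm_sub_le x y u
      rwa [← supNorm_neg' (y - u), neg_sub] at this
    have hrad : (rieszRadius (x - u) : ℝ) ≤ 3 * rieszRadius (u - y) := by
      rw [rieszRadius_eq_supNorm (by omega : 1 ≤ Site.supNorm (x - u)),
        rieszRadius_eq_supNorm (by omega : 1 ≤ Site.supNorm (u - y))]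
      exact_mod_cast (by omega : Site.supNorm (x - u) ≤ 3 * Site.supNorm (u - y))
    have hw : rieszWt (t + 2 + i) (u - y) ≤ 3 ^ (t + 2 + i) * rieszWt (t + 2 + i) (x - u) := by
      rw [rieszWt, rieszWt, show (3 : ℝ) ^ (t + 2 + i) * (((rieszRadius (x - u) : ℕ) : ℝ) ^ (t + 2 + i))⁻¹ =
        (((((rieszRadius (x - u) : ℕ) : ℝ)) / 3) ^ (t + 2 + i))⁻¹ by rw [div_pow, inv_div, div_eq_mul_inv]]
      refine inv_anti₀ (pow_pos (by have := rieszRadius_pos (x - u); positivity) _)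
        (pow_le_pow_left₀ (by have := rieszRadius_pos (x - u); positivity) ?_ _)
      linarith
    calc rieszWt (t + 2 + j) (x - u) * rieszWt (t + 2 + i) (u - y)
        ≤ rieszWt (t + 2 + j) (x - u) * (3 ^ (t + 2 + i) * rieszWt (t + 2 + i) (x - u)) :=
          mul_le_mul_of_nonneg_left hw (rieszWt_nonneg _ _)
      _ = 3 ^ (t + 2 + i) * (rieszWt (t + 2 + j) (x - u) * rieszWt (t + 2 + i) (x - u)) := by ring
      _ = 3 ^ (t + 2 + i) * rieszWt (d + 1 + t) (x - u) := by
          rw [← rieszWt_add, show t + 2 + j + (t + 2 + i) = d + 1 + t by omega]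
  have hsub : S.filter (fun u => x - u ∉ box d h ∧ u - y ∉ box d h) ⊆ S.filter (fun u => x - u ∉ box d h) := by
    intro u hu
    rw [Finset.mem_filter] at hu ⊢
    exact ⟨hu.1, hu.2.1⟩
  have htail : ((((h : ℝ) + 1)) ^ (t + 1))⁻¹ ≤ 2 ^ (t + 1) * ((((R : ℕ) : ℝ)) ^ (t + 1))⁻¹ := by
    have := inv_pow_le_two_pow_mul_inv_pow (h' := h + 1) (t + 1) hR1 h2
    push_cast at this
    exact this
  calc ∑ u ∈ S with (x - u ∉ box d h ∧ u - y ∉ box d h), rieszWt (t + 2 + j) (x - u) * rieszWt (t + 2 + i) (u - y)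
      ≤ ∑ u ∈ S with (x - u ∉ box d h ∧ u - y ∉ box d h), 3 ^ (t + 2 + i) * rieszWt (d + 1 + t) (x - u) :=
        Finset.sum_le_sum hpt
    _ ≤ ∑ u ∈ S with x - u ∉ box d h, 3 ^ (t + 2 + i) * rieszWt (d + 1 + t) (x - u) :=
        Finset.sum_le_sum_of_subset_of_nonneg hsub fun u _ _ => by
          have := rieszWt_nonneg (d + 1 + t) (x - u); positivity
    _ = 3 ^ (t + 2 + i) * ∑ u ∈ S with x - u ∉ box d h, rieszWt (d + 1 + t) (x - u) := by
        rw [Finset.mul_sum]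
    _ ≤ 3 ^ (t + 2 + i) * (rieszTailConst d * ((((h : ℝ) + 1)) ^ (t + 1))⁻¹) :=
        mul_le_mul_of_nonneg_left (sum_filter_sub_left_not_mem_box_le hd1 t h x S) (by positivity)
    _ ≤ 3 ^ (t + 2 + i) * (rieszTailConst d * (2 ^ (t + 1) * ((((R : ℕ) : ℝ)) ^ (t + 1))⁻¹)) := by
        gcongr
        exact rieszTailConst_nonneg d
    _ = 3 ^ (t + 2 + i) * 2 ^ (t + 1) * rieszTailConst d * ((((R : ℕ) : ℝ)) ^ (t + 1))⁻¹ := by ring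

/-- **The degenerate case `x = y`** of the convolution bound:
`Σ_u rieszRadius(x-u)^{-(α+β)} ≤ 1 + K₂`. [folklore] -/
theorem convolution_diag {t i j : ℕ} (hd : d = t + 3 + i + j) (x : Site d) (S : Finset (Site d)) :
    ∑ u ∈ S, rieszWt (t + 2 + j) (x - u) * rieszWt (t + 2 + i) (u - x) ≤ 1 + rieszTailConst d := by
  classical
  have hd1 : 1 ≤ d := by omega
  have hrw : ∀ u, rieszWt (t + 2 + j) (x - u) * rieszWt (t + 2 + i) (u - x) = rieszWt (d + 1 + t) (x - u) := by
    intro u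
    rw [rieszWt_sub_comm (t + 2 + i) u x, ← rieszWt_add, show t + 2 + j + (t + 2 + i) = d + 1 + t by omega]
  simp_rw [hrw]
  rw [← Finset.sum_filter_add_sum_filter_not S (fun u => x - u ∈ box d 0)]
  refine add_le_add ?_ (sum_filter_sub_left_not_mem_box_le hd1 t 0 x S |>.trans (by simp))
  -- the centre: at most the single point `u = x`, weight `1`
  calc ∑ u ∈ S with x - u ∈ box d 0, rieszWt (d + 1 + t) (x - u)
      ≤ ∑ w ∈ box d 0, rieszWt (d + 1 + t) w := by
        rw [sum_sub_left_eq_sum_image (rieszWt (d + 1 + t)) x]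
        refine Finset.sum_le_sum_of_subset_of_nonneg ?_ fun z _ _ => rieszWt_nonneg _ z
        intro w hw
        obtain ⟨u, hu, rfl⟩ := Finset.mem_image.1 hw
        exact (Finset.mem_filter.1 hu).2
    _ = 1 := by rw [box_zero_eq_singleton, Finset.sum_singleton, rieszWt_zero]

/-- **Discrete convolution of two Riesz weights** (the case `a < d`, `a + b > d` of the
convolution bound of Hara–van der Hofstad–Slade 2003, Prop. 1.7 (i): `|(f*g)(x)| ≤
C(|x|+1)^{d-(a+b)}` when `|f| ≤ (|x|+1)^{-a}`, `|g| ≤ (|x|+1)^{-b}`; stated here for the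
regularised sup-norm weights and for finite partial sums, with an explicit constant): with
`α = t+2+j`, `β = t+2+i`, `d = t+3+i+j` (so `α, β ≤ d - 1` and `α + β = d + (t+1)`), uniformly over
finite summation ranges `S`,
`Σ_{u ∈ S} rieszRadius(x-u)^{-α} rieszRadius(u-y)^{-β} ≤ K rieszRadius(x-y)^{-(α+β-d)}`.
Proof: split `u` according to `‖x-u‖ ≤ R/2`, `‖u-y‖ ≤ R/2`, or neither (`R = ‖x-y‖`), and use the
ball and tail sums. [cite: HaraHofstadSlade2003, Prop. 1.7 (i) (Prop. 1.3.2 (i) of arXiv:math-ph/0011046), case a < d, a + b > d] -/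
theorem sum_rieszWt_mul_rieszWt_le {t i j : ℕ} (hd : d = t + 3 + i + j) (x y : Site d)
    (S : Finset (Site d)) :
    ∑ u ∈ S, rieszWt (t + 2 + j) (x - u) * rieszWt (t + 2 + i) (u - y) ≤
      rieszConvConst d * rieszWt (t + 1) (x - y) := by
  classical
  have hK₁ := one_le_rieszBallConst d
  have hK₂ := rieszTailConst_nonneg d
  set R := Site.supNorm (x - y) with hRdef
  rcases Nat.eq_zero_or_pos R with hR0 | hR1
  · -- `x = y`
    have hxy : x = y := sub_eq_zero.1 (Site.supNorm_eq_zero_iff.1 hR0)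
    subst hxy
    rw [sub_self, rieszWt_zero, mul_one]
    refine (convolution_diag hd x S).trans ?_
    rw [rieszConvConst]
    have : (0 : ℝ) ≤ 2 ^ (d + 1) * rieszBallConst d + 8 ^ d * rieszTailConst d := by positivity
    linarith
  · -- `R ≥ 1`: three regions
    set h := R / 2 with hh
    have hhh' : h + (R - h) = R := by omega
    have h2 : R ≤ 2 * (R - h) := by omega
    have hhR : h + 1 ≤ R := by omega
    have h2' : R ≤ 2 * (h + 1) := by omega
    have hA := convolution_regionA (t := t) (i := i) (j := j) hd hRdef.symm hR1 hhh' h2 hhR S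
    have hB := convolution_regionB (t := t) (i := i) (j := j) hd hRdef.symm hR1 hhh' h2 hhR
      (S.filter fun u => x - u ∉ box d h)
    have hC := convolution_regionC (t := t) (i := i) (j := j) hd hRdef.symm hR1 h2' S
    rw [Finset.filter_filter] at hB
    have hsplit : ∑ u ∈ S, rieszWt (t + 2 + j) (x - u) * rieszWt (t + 2 + i) (u - y) =
        (∑ u ∈ S with x - u ∈ box d h, rieszWt (t + 2 + j) (x - u) * rieszWt (t + 2 + i) (u - y)) +
        ((∑ u ∈ S with (x - u ∉ box d h ∧ u - y ∈ box d h),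
            rieszWt (t + 2 + j) (x - u) * rieszWt (t + 2 + i) (u - y)) +
          ∑ u ∈ S with (x - u ∉ box d h ∧ u - y ∉ box d h),
            rieszWt (t + 2 + j) (x - u) * rieszWt (t + 2 + i) (u - y)) := by
      rw [← Finset.sum_filter_add_sum_filter_not S (fun u => x - u ∈ box d h),
        ← Finset.sum_filter_add_sum_filter_not (S.filter fun u => x - u ∉ box d h) (fun u => u - y ∈ box d h),
        Finset.filter_filter, Finset.filter_filter]
    rw [hsplit]
    -- the weight on the right is `R^{-γ}`
    have hw : rieszWt (t + 1) (x - y) = ((((R : ℕ) : ℝ)) ^ (t + 1))⁻¹ := by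
      rw [rieszWt, rieszRadius_eq_supNorm (by omega : 1 ≤ Site.supNorm (x - y))]
    rw [hw]
    refine ((add_le_add hA (add_le_add hB hC))).trans ?_
    have hR0 : (0 : ℝ) < (((R : ℕ) : ℝ)) ^ (t + 1) := by positivity
    rw [← add_mul, ← add_mul]
    refine mul_le_mul_of_nonneg_right ?_ (inv_nonneg.2 hR0.le)
    -- constants: `2^β K₁ + 2^α K₁ + 3^β 2^γ K₂ ≤ rieszConvConst d`
    have hβ : (2 : ℝ) ^ (t + 2 + i) ≤ 2 ^ d := pow_le_pow_right₀ (by norm_num) (by omega)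
    have hα : (2 : ℝ) ^ (t + 2 + j) ≤ 2 ^ d := pow_le_pow_right₀ (by norm_num) (by omega)
    have hγ : (3 : ℝ) ^ (t + 2 + i) * 2 ^ (t + 1) ≤ 8 ^ d := by
      have h3 : (3 : ℝ) ^ (t + 2 + i) ≤ 4 ^ (t + 2 + i) := pow_le_pow_left₀ (by norm_num) (by norm_num) _
      have h2 : (2 : ℝ) ^ (t + 1) ≤ 2 ^ (t + 2 + i) := pow_le_pow_right₀ (by norm_num) (by omega)
      calc (3 : ℝ) ^ (t + 2 + i) * 2 ^ (t + 1) ≤ 4 ^ (t + 2 + i) * 2 ^ (t + 2 + i) :=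
            mul_le_mul h3 h2 (by positivity) (by positivity)
        _ = 8 ^ (t + 2 + i) := by rw [← mul_pow]; norm_num
        _ ≤ 8 ^ d := pow_le_pow_right₀ (by norm_num) (by omega)
    rw [rieszConvConst]
    have hK₁0 : (0 : ℝ) ≤ rieszBallConst d := le_trans zero_le_one hK₁
    have hpow : (2 : ℝ) ^ (d + 1) = 2 * 2 ^ d := by ring
    nlinarith [mul_le_mul_of_nonneg_right hβ hK₁0, mul_le_mul_of_nonneg_right hα hK₁0,
      mul_le_mul_of_nonneg_right hγ hK₂, hpow]

end Convolution


/-! ### Plates (hyperplane sections of the box) and plate sums -/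

section Plates

variable {n : ℕ}

/-- The embedding `ℤ^n ↪ ℤ^{n+1}`, `x' ↦ (c, x')` onto the hyperplane `{x₀ = c}`. [folklore] -/
def plateEmb (c : ℤ) : Site n ↪ Site (n + 1) :=
  ⟨fun x' => Fin.cons (α := fun _ => ℤ) c x', Fin.cons_right_injective (α := fun _ => ℤ) c⟩

/-- First coordinate of `plateEmb c x'`. [folklore] -/
@[simp] theorem plateEmb_apply_zero (c : ℤ) (x' : Site n) : plateEmb c x' 0 = c := rfl

/-- Later coordinates of `plateEmb c x'`. [folklore] -/
@[simp] theorem plateEmb_apply_succ (c : ℤ) (x' : Site n) (i : Fin n) : plateEmb c x' i.succ = x' i :=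
  Fin.cons_succ (α := fun _ => ℤ) c x' i

/-- `Fin.tail (plateEmb c x') = x'`. [folklore] -/
@[simp] theorem tail_plateEmb (c : ℤ) (x' : Site n) : Fin.tail (plateEmb c x') = x' :=
  funext fun i => plateEmb_apply_succ c x' i

/-- `x = (x₀, Fin.tail x)`. [folklore] -/
theorem plateEmb_tail (x : Site (n + 1)) : plateEmb (x 0) (Fin.tail x) = x :=
  Fin.cons_self_tail (α := fun _ => ℤ) x

/-- The **plate** `{x ∈ ℤ^{n+1} | x₀ = c, (x₁,…,x_n) ∈ Λ_L^{(n)}}`, the section `{x₀ = c}` of the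
cylinder over the `n`-dimensional box; for `|c| ≤ L` it equals `{x ∈ Λ_L | x₀ = c}`
(`plate_subset_box`), and the faces `∂Λ_∓ = {x ∈ Λ_L | x₁ = ∓L}` of Aizenman 1997, §4 are the plates
`c = ∓L` (`coe_plate_neg_eq_leftFace`, `coe_plate_eq_rightFace`).
[cite: Aizenman1997, §4 (Λ_L = [-L,L]^d, ∂Λ_∓)] -/
def plate (n L : ℕ) (c : ℤ) : Finset (Site (n + 1)) := (box n L).map (plateEmb c)

/-- Membership in a plate: first coordinate `c`, remaining coordinates in `Λ_L`. [folklore] -/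
theorem mem_plate {L : ℕ} {c : ℤ} {x : Site (n + 1)} :
    x ∈ plate n L c ↔ x 0 = c ∧ (Fin.tail x : Site n) ∈ box n L := by
  constructor
  · intro h
    obtain ⟨x', hx', rfl⟩ := Finset.mem_map.1 h
    exact ⟨rfl, by rwa [tail_plateEmb]⟩
  · rintro ⟨h0, ht⟩
    refine Finset.mem_map.2 ⟨Fin.tail x, ht, ?_⟩
    rw [← h0]
    exact plateEmb_tail x

/-- `|plate| = (2L+1)^n`. [folklore] -/
theorem card_plate (n L : ℕ) (c : ℤ) : #(plate n L c) = (2 * L + 1) ^ n := by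
  rw [plate, Finset.card_map, card_box]

/-- A plate with `|c| ≤ L` lies in the box `Λ_L`. [folklore] -/
theorem plate_subset_box {L : ℕ} {c : ℤ} (hc : -(L : ℤ) ≤ c ∧ c ≤ L) : plate n L c ⊆ box (n + 1) L := by
  intro x hx
  obtain ⟨h0, ht⟩ := mem_plate.1 hx
  rw [mem_box] at ht ⊢
  intro i
  refine Fin.cases ?_ (fun i => ?_) i
  · rw [h0]; exact hc
  · exact ht i

/-- The plate `c = -L` is the left face `∂Λ_- = {x ∈ Λ_L | x₁ = -L}` of
`SpanningClustersAboveSix.lean`. [cite: Aizenman1997, §4 (∂Λ_-)] -/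
theorem coe_plate_neg_eq_leftFace (n L : ℕ) :
    (↑(plate n L (-(L : ℤ))) : Set (Site (n + 1))) = leftFace (n + 1) L := by
  ext x
  rw [Finset.mem_coe, leftFace, Set.mem_setOf_eq]
  constructor
  · intro hx
    exact ⟨plate_subset_box ⟨le_rfl, by omega⟩ hx, (mem_plate.1 hx).1⟩
  · rintro ⟨hbox, h0⟩
    refine mem_plate.2 ⟨h0, ?_⟩
    rw [mem_box] at hbox ⊢
    exact fun i => hbox i.succ

/-- The plate `c = L` is the right face `∂Λ_+ = {x ∈ Λ_L | x₁ = L}` of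
`SpanningClustersAboveSix.lean`. [cite: Aizenman1997, §4 (∂Λ_+)] -/
theorem coe_plate_eq_rightFace (n L : ℕ) :
    (↑(plate n L (L : ℤ)) : Set (Site (n + 1))) = rightFace (n + 1) L := by
  ext x
  rw [Finset.mem_coe, rightFace, Set.mem_setOf_eq]
  constructor
  · intro hx
    exact ⟨plate_subset_box ⟨by omega, le_rfl⟩ hx, (mem_plate.1 hx).1⟩
  · rintro ⟨hbox, h0⟩
    refine mem_plate.2 ⟨h0, ?_⟩
    rw [mem_box] at hbox ⊢
    exact fun i => hbox i.succ

/-- Dropping the first coordinate does not increase the sup norm. [folklore] -/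
theorem supNorm_tail_le (z : Site (n + 1)) : Site.supNorm (Fin.tail z : Site n) ≤ Site.supNorm z :=
  Site.supNorm_le_iff.2 fun i => Site.natAbs_le_supNorm z i.succ

/-- `rieszRadius (Fin.tail z) ≤ rieszRadius z`. [folklore] -/
theorem rieszRadius_tail_le (z : Site (n + 1)) : rieszRadius (Fin.tail z : Site n) ≤ rieszRadius z :=
  max_le_max le_rfl (supNorm_tail_le z)

/-- `rieszWt a z ≤ rieszWt a (Fin.tail z)`. [folklore] -/
theorem rieszWt_le_rieszWt_tail (a : ℕ) (z : Site (n + 1)) :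
    rieszWt a z ≤ rieszWt a (Fin.tail z : Site n) :=
  rieszWt_le_rieszWt_of_rieszRadius_le a (rieszRadius_tail_le z)

/-- `Fin.tail` is additive on `ℤ^{n+1}`: `tail (x - u) = tail x - tail u`. [folklore] -/
theorem tail_sub (x u : Site (n + 1)) : (Fin.tail (x - u) : Site n) = Fin.tail x - Fin.tail u := rfl

/-- Points of `Λ_L` are within sup distance `2L` of each other. [folklore] -/
theorem supNorm_sub_le_of_mem_box {d L : ℕ} {x y : Site d} (hx : x ∈ box d L) (hy : y ∈ box d L) :
    Site.supNorm (x - y) ≤ 2 * L := by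
  rw [mem_box_iff_supNorm_le] at hx hy
  have h := Site.supNorm_add_le x (-y)
  rw [← sub_eq_add_neg, supNorm_neg'] at h
  omega

/-- Opposite faces are at sup distance at least `2L`: for `x₀ = -L`, `y₀ = L`,
`‖x - y‖_∞ ≥ 2L`. [folklore] -/
theorem two_mul_le_supNorm_sub_of_mem_plate {L : ℕ} {x y : Site (n + 1)} (hx : x ∈ plate n L (-(L : ℤ)))
    (hy : y ∈ plate n L L) : 2 * L ≤ Site.supNorm (x - y) := by
  have h0 : (x - y) 0 = -(2 * (L : ℤ)) := by
    rw [Pi.sub_apply, (mem_plate.1 hx).1, (mem_plate.1 hy).1]; ring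
  have h := Site.natAbs_le_supNorm (x - y) 0
  rw [h0] at h
  omega

/-- The constant `K₁ + 1` of the plate sums. [folklore] -/
def rieszPlateConst (n : ℕ) : ℝ := rieszBallConst n + 1

/-- `rieszPlateConst n ≥ 1`. [folklore] -/
theorem one_le_rieszPlateConst (n : ℕ) : 1 ≤ rieszPlateConst n := by
  have := one_le_rieszBallConst n; unfold rieszPlateConst; linarith

/-- **Off-centre box sum** in `ℤ^n`, `n = a + 1`: `Σ_{x' ∈ Λ_L} rieszRadius(x' - w)^{-a} ≤ (K₁+1)(2L+1)`
uniformly in the centre `w` (points within `2L` of `w` by the ball sum, the others have weight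
`≤ (2L+1)^{-a}` and number `≤ (2L+1)^n`). [folklore] -/
theorem sum_box_rieszWt_sub_le {a : ℕ} (hn : n = a + 1) (L : ℕ) (w : Site n) :
    ∑ x' ∈ box n L, rieszWt a (x' - w) ≤ rieszPlateConst n * (2 * (L : ℝ) + 1) := by
  classical
  rw [rieszPlateConst, ← Finset.sum_filter_add_sum_filter_not (box n L) (fun x' => x' - w ∈ box n (2 * L)), add_mul]
  refine add_le_add ?_ ?_
  · have h := sum_filter_sub_right_mem_box_le (a := a) (e := 0) (by omega) w (2 * L) (box n L)
    rw [zero_add, pow_one] at h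
    refine h.trans (le_of_eq ?_)
    push_cast; ring
  · have hterm : ∀ x' ∈ (box n L).filter (fun x' => x' - w ∉ box n (2 * L)),
        rieszWt a (x' - w) ≤ ((((2 * L + 1 : ℕ) : ℝ)) ^ a)⁻¹ := by
      intro x' hx'
      have h := (Finset.mem_filter.1 hx').2
      rw [mem_box_iff_supNorm_le, not_le] at h
      exact rieszWt_le_inv_pow a (by omega) (by omega)
    calc ∑ x' ∈ box n L with x' - w ∉ box n (2 * L), rieszWt a (x' - w)
        ≤ #((box n L).filter (fun x' => x' - w ∉ box n (2 * L))) • ((((2 * L + 1 : ℕ) : ℝ)) ^ a)⁻¹ :=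
          Finset.sum_le_card_nsmul _ _ _ hterm
      _ ≤ #(box n L) • ((((2 * L + 1 : ℕ) : ℝ)) ^ a)⁻¹ :=
          nsmul_le_nsmul_left (inv_nonneg.2 (by positivity)) (Finset.card_le_card (Finset.filter_subset _ _))
      _ = 1 * (2 * (L : ℝ) + 1) := by
          rw [card_box, nsmul_eq_mul, hn, pow_succ]
          push_cast
          have : (0 : ℝ) < 2 * L + 1 := by positivity
          field_simp

/-- **Plate sum** (the lattice estimate behind `E|C(u) ∩ ∂Λ_∓| ≲ L`, Aizenman 1997, §4): for a
plate in `ℤ^{n+1}`, `n = a + 1` (so the weight exponent is `a = d - 2`),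
`Σ_{x ∈ plate} rieszRadius(x - u)^{-a} ≤ (K₁+1)(2L+1)` uniformly in `u ∈ ℤ^{n+1}` (project onto the last
`n` coordinates). [cite: Aizenman1997, §4 (proof of Lemma 3: E(K))] -/
theorem sum_plate_rieszWt_sub_le {a : ℕ} (hn : n = a + 1) (L : ℕ) (c : ℤ) (u : Site (n + 1)) :
    ∑ x ∈ plate n L c, rieszWt a (x - u) ≤ rieszPlateConst n * (2 * (L : ℝ) + 1) := by
  rw [plate, Finset.sum_map]
  calc ∑ x' ∈ box n L, rieszWt a (plateEmb c x' - u)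
      ≤ ∑ x' ∈ box n L, rieszWt a (Fin.tail (plateEmb c x' - u)) :=
        Finset.sum_le_sum fun x' _ => rieszWt_le_rieszWt_tail a _
    _ = ∑ x' ∈ box n L, rieszWt a (x' - Fin.tail u) := by
        refine Finset.sum_congr rfl fun x' _ => ?_
        rw [tail_sub, tail_plateEmb]
    _ ≤ rieszPlateConst n * (2 * (L : ℝ) + 1) := sum_box_rieszWt_sub_le hn L (Fin.tail u)

/-- Plate sum with the weight centred the other way, `Σ_{x ∈ plate} rieszRadius(u - x)^{-a}`. [folklore] -/
theorem sum_plate_rieszWt_sub_le' {a : ℕ} (hn : n = a + 1) (L : ℕ) (c : ℤ) (u : Site (n + 1)) :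
    ∑ x ∈ plate n L c, rieszWt a (u - x) ≤ rieszPlateConst n * (2 * (L : ℝ) + 1) := by
  simp_rw [rieszWt_sub_comm a u]
  exact sum_plate_rieszWt_sub_le hn L c u

end Plates

end Literature.Barriers.CriticalPhenomena

end
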